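import Summits.Ventures.HodgeRepro2.T5SU11UnipotentSubgroup

/-!
# The unipotent subgroup on the Bergman space: `π_k(n_s)` on monomials and its generator

The weight-`k` action of the unipotent element `n_s = su11 (1 + i s) (-i s)` of
`T5SU11UnipotentSubgroup` on the monomials `zⁿ` of the Bergman space is explicit:

  `(π_k(n_s) zⁿ)(w) = (1 + i s (1 - w))^{-(k+n)} · (w + i s (1 - w))ⁿ`

(`act_unip_monomial`; the automorphy factor `j(n_s⁻¹, w) = 1 + i s (1 - w)` and the Möbius image
`n_s⁻¹ · w = (w + i s(1 - w)) / (1 + i s (1 - w))`), in particular `π_k(n_s) 1 = (1 + i s (1 - w))^{-k}`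
(`act_unip_lowest`). The derivative at `s = 0` is the UNIPOTENT GENERATOR on monomials,

  `d/ds|₀ π_k(n_s) zⁿ = i ((k + n) z^{n+1} - (k + 2n) zⁿ + n z^{n-1})`

(`hasDerivAt_act_unip_monomial`), i.e. `i (E₊ - H - E₋)` in terms of the ladder and weight operators
of `T5BergmanLadder` (`raise_monomial`: `E₊ zⁿ = (k+n) z^{n+1}`, `weight_monomial`: `H zⁿ = (k+2n) zⁿ`,
`lower_monomial`: `E₋ zⁿ = -n z^{n-1}`): the generator of `N` in the `(𝔤, K)`-module of the explicit
model is `i (E₊ - H - E₋)`; on the lowest-weight vector it is `i k (z - 1)` (`hasDerivAt_act_unip_lowest`).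
Nothing is claimed about (N).

Blind lane: Mathlib + the HodgeRepro2 prefix only; no sorry; axioms ⊆ {propext, Classical.choice,
Quot.sound}.
-/

namespace Summit.Ventures.HodgeRepro2.T5BergmanUnipotentAction

open Metric Filter Topology Set Complex
open T5UnitaryBound T5PoincareDensity T5PoincareInvariance T5SU11Unimodular T5SU11Fibration
  T5SU11Cartan T5SU11OneParameter T5BergmanCoefficient T5BergmanLadder T5SU11UnipotentSubgroup

/-! ### `π_k(n_s)` on monomials -/

/-- **`n_s` on monomials**: `(π_k(n_s) zⁿ)(w) = (1 + i s (1 - w))^{-(k+n)} (w + i s (1 - w))ⁿ`. -/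
theorem act_unip_monomial (k n : ℕ) (s : ℝ) (w : ℂ) :
    act k (unip s) (fun z => z ^ n) w =
      (1 + (s : ℂ) * (I * (1 - w)))⁻¹ ^ (k + n) * (w + (s : ℂ) * (I * (1 - w))) ^ n := by
  unfold act
  rw [mat_unip_inv, denom_su11, mobius_su11]
  simp only [map_sub, map_mul, map_one, Complex.conj_ofReal, Complex.conj_I]
  rw [div_pow, pow_add, div_eq_mul_inv, ← inv_pow]
  ring_nf

/-- **`n_s` on the lowest-weight vector**: `(π_k(n_s) 1)(w) = (1 + i s (1 - w))^{-k}`. -/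
theorem act_unip_lowest (k : ℕ) (s : ℝ) (w : ℂ) :
    act k (unip s) lowest w = (1 + (s : ℂ) * (I * (1 - w)))⁻¹ ^ k := by
  have h := act_unip_monomial k 0 s w
  simp only [pow_zero, mul_one, add_zero] at h
  unfold lowest
  unfold act at h ⊢
  simpa using h

/-! ### The unipotent generator -/

/-- `s ↦ (s : ℂ)` has derivative `1`. -/
lemma hasDerivAt_ofReal (s : ℝ) : HasDerivAt (fun s : ℝ => (s : ℂ)) 1 s := by
  have := (hasDerivAt_id s).ofReal_comp
  simpa using this

/-- **The unipotent generator on monomials**: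
`d/ds|₀ π_k(n_s) zⁿ = i ((k + n) z^{n+1} - (k + 2n) zⁿ + n z^{n-1})`. -/
theorem hasDerivAt_act_unip_monomial (k n : ℕ) (w : ℂ) :
    HasDerivAt (fun s : ℝ => act k (unip s) (fun z => z ^ n) w)
      (I * (((k : ℂ) + n) * w ^ (n + 1) - ((k : ℂ) + 2 * n) * w ^ n + (n : ℂ) * w ^ (n - 1))) 0 := by
  simp_rw [act_unip_monomial]
  have hA : HasDerivAt (fun s : ℝ => 1 + (s : ℂ) * (I * (1 - w))) (I * (1 - w)) 0 := by
    have := ((hasDerivAt_ofReal 0).mul_const (I * (1 - w))).const_add 1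
    simpa using this
  have hB : HasDerivAt (fun s : ℝ => w + (s : ℂ) * (I * (1 - w))) (I * (1 - w)) 0 := by
    have := ((hasDerivAt_ofReal 0).mul_const (I * (1 - w))).const_add w
    simpa using this
  have hne : (1 : ℂ) + ((0 : ℝ) : ℂ) * (I * (1 - w)) ≠ 0 := by simp
  have h3 := ((hA.inv hne).pow (k + n)).mul (hB.pow n)
  refine h3.congr_deriv ?_
  simp only [Pi.inv_apply, Pi.pow_apply, Complex.ofReal_zero, zero_mul, add_zero, inv_one, one_pow,
    mul_one, one_mul, Nat.cast_add, div_one]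
  rcases n with _ | m
  · simp
    ring
  · simp only [Nat.add_sub_cancel, Nat.cast_succ]
    ring

/-- The generator on the lowest-weight vector: `d/ds|₀ π_k(n_s) 1 = i k (z - 1)`. -/
theorem hasDerivAt_act_unip_lowest (k : ℕ) (w : ℂ) :
    HasDerivAt (fun s : ℝ => act k (unip s) lowest w) (I * (k : ℂ) * (w - 1)) 0 := by
  have h := hasDerivAt_act_unip_monomial k 0 w
  have e : (fun s : ℝ => act k (unip s) (fun z => z ^ 0) w) = fun s : ℝ => act k (unip s) lowest w := by
    funext s
    unfold act lowest
    simp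
  rw [e] at h
  refine h.congr_deriv ?_
  simp
  ring

end Summit.Ventures.HodgeRepro2.T5BergmanUnipotentAction
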